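/-
Copyright (c) 2026 the pub-hodgecm-mathlib formalisation cell (harness21).  Prover seat hodgecm-mathlib-K2E5-p17 (g8), Track B «K2-LIT»,
#184♮ = hLiu418 = `stmt-HodgeConjecture-24832`; socket #41 `sig_K2LiuSiegelEisensteinContinuation` (U6 ED. 12 :289–:306), THE TOP — author of record by LEAD F0P6-plan (g14)
BATCH #46 (a) 2026-09-04T15:13:05Z; typist desk K2Liu-typ2 (g0) (`core41.fragment`, TIE-PROBE #41 v0 certified the last line); sheet desk K2E5-plan (g7).
THEOREMS ONLY (no `def`, no `instance`, no notation, no named-fact hypothesis, no `sorry`); NO `Lines` import — the typist ties.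
-/
import Summits.HodgeConjecture.HodgeConjecture.Theorems.K2LiuSiegelEisensteinAssembly        -- ★ Φ9 `exists_continuation_package_of_term_packages` (+ ★ #10b left invariance)
import Summits.HodgeConjecture.HodgeConjecture.Theorems.K2LiuSiegelFourierExpansionDelta      -- ★ Φ1 `hasSum_fourierCoeffDelta` (index `skewMatrices`, carrier `fourierCoeffDelta`)
import Summits.HodgeConjecture.HodgeConjecture.Theorems.K2LiuSiegelEisensteinContinuous       -- ★ G8 `continuous_eisensteinSeriesDelta_unipDelta_mul` (Φ1's `hφc` at `φ = E^Δ`)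
import Summits.HodgeConjecture.HodgeConjecture.Theorems.K2LiuRankOneCentralVanishing          -- ★ S5-F2 `slice_invariant` (Φ1's `hφ` from left-`H(L⁺)`-invariance)
import Literature.NumberTheory.Automorphic.IdeleClassCharacterHecke                          -- ★ `toHeckeCharacter`, `isUnitary_toHeckeCharacter`
import Literature.NumberTheory.K2Lit.SiegelStandardSections                                  -- ★ `IwasawaDatum`, `IsStandardSectionFamily` (socket binders)
import Literature.NumberTheory.K2Lit.SiegelStandardIwasawaData                               -- ★ `IwasawaDatum.IsStd`
import Literature.NumberTheory.Automorphic.AdelicGLnGlue                                     -- ★ `adelicHeightGL` (clause (A5))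
import Summits.HodgeConjecture.HodgeConjecture.Theorems.K2LiuSiegelUnipotentHaarPinned         -- ★ Φ3b: `locallyCompactSpace_unipDelta` (edition 2: Haar measure on `N_Δ(𝔸)`)
import Summits.HodgeConjecture.HodgeConjecture.Theorems.K2LiuUnipotentCocompact               -- ★ (C0) `exists_isCompact_cover_unipDelta` (edition 2)
import Summits.HodgeConjecture.HodgeConjecture.Theorems.K2LiuUnipotentCoveringWeight          -- ★ `exists_isCoveringWeight_unipDeltaRat_lintegral_ne_top`, `countable_unipDeltaRat` (edition 2)
import Summits.HodgeConjecture.HodgeConjecture.Theorems.K2LiuUnipDeltaConjMeasurePreserving   -- ★ `lintegral_ne_zero_of_isCoveringWeight` (edition 2)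
import HarnessLib

/-!
# Crux `HLiu418`, socket #41 — THE TOP: `sig_K2LiuSiegelEisensteinContinuation` FROM THE ROWS OF ROAD Φ, edition 1
# (index type, Fourier expansion and symmetry DISCHARGED; the term packages, the majorant and the summed growth BY VALUE in ★ Φ1's coefficient currency)

Cell `hodgecm-mathlib`, crux item hLiu418 = `stmt-HodgeConjecture-24832` (helper lane until the typist's tie; count-neutral).

THE SOCKET (U6 ED. 12 :289–:305, frozen M-156a): for the curve frame `e : Fin 2 × Fin 1 ≃ Fin n`, a conjugate-symplectic weight-one `lam`, a STANDARD Iwasawa datum `𝒦` and a standard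
continuous family `f` of Siegel sections of `I_Δ(s, χ)`, `χ := toHeckeCharacter L lam⁻¹`:  `∃ (P : Finset ℂ) (Es : ℂ → H(𝔸) → ℂ)`, (A1) holomorphic on `{0 < re}` in `s`, (A2) continuous in `h`,
(A3) left-`H(L⁺)`-invariant, (A4) `= (∏_{p∈P}(s − p))·E^Δ(h; f_s)` on `{n∕2 < re}`, (A5) of locally uniform moderate growth in ★ `adelicHeightGL`.
THE ROAD (RULING «M-156n», sheet `K2/K2E5-plan/g7/CENSUS-41-Phi9-ConsumerSheet.K2E5-plan-g7.md` fa2b1e3a29709f09): ★ Φ9 `K2LiuSiegelEisensteinAssembly.exists_continuation_package_of_term_packages`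
turns TERM PACKAGES `Ec i` (holomorphic in `s`, continuous in `h`) summing to `(∏(s−p))·E^Δ` on the convergence half-plane, with ONE locally uniform summable majorant and summed growth,
into the five clauses — its last line is the TOP's, certified cast-free against the socket bytes by K2Liu-typ2 (g0)'s TIE-PROBE #41 v0 (`tieProbe_41_core`, organ side `horgans` BY VALUE).
THIS EDITION discharges, relative to `horgans`: the INDEX TYPE (`ι :=` ★ Φ1's lattice `skewMatrices` of the doubled hermitian space), the EXPANSION `heq` (★ Φ1 `hasSum_fourierCoeffDelta`
at `φ := E^Δ(·; f_s)`: `hφc` by ★ G8 `continuous_eisensteinSeriesDelta_unipDelta_mul` with `χ` unitary by ★ `isUnitary_toHeckeCharacter`, `hφ` by ★ #10b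
`siegelEisensteinDoubledLeftInvariant` through ★ `slice_invariant`, `hsum` from the majorant at the point — or trivially when `∏(s−p) = 0`), and the symmetry (A3) (inside ★ Φ9).  What enters
BY VALUE, in ★ Φ1's COEFFICIENT CURRENCY (the shape every payer's clause (iv) has): a Fourier carrier (`νN` left-invariant on `N_Δ(𝔸)`, a covering weight `β` of positive finite mass —
★ Φ3b ∕ ★ `K2LiuSiegelEisensteinMajorantLocallyBounded` supply them), the pole set `P`, the TERM PACKAGES `Ec S` INDEXED BY THE LATTICE with (i) holomorphy, (ii) continuity and the
COEFFICIENT IDENTITY `Ec S s h = (∏_{p∈P}(s−p))·(E^Δ(·; f_s))_S(h)` on `{n∕2 < re}` — paid per kind by the ★ packages: `det S ≠ 0` Whittaker (rows G1–G4), `S ≠ 0`, `det S = 0` the CLEARED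
rank-one package ★ `K2LiuSiegelEisensteinRankOneTermPackageCleared.exists_rankOne_package_cleared` (G5-b), `S = 0` identity + ★ rank-zero `exists_middle_package` + Φ8 big cell (G5-a, G6) — and
Φ9's majorant `hmaj` and summed growth `hgrowth` (G4 × G5 × G7).  Editions 2+ append heads taking those per kind in their own ★ currencies; §3 EDITION 2
`siegelEisensteinContinuation_of_rows₂` builds the Fourier carrier inside (★ Φ3b, ★ (C0), ★ covering weight) and takes `hcoef` carrier-generic.
HEAD **`siegelEisensteinContinuation_of_rows`**: socket binders, then the organ side above ⇒ the socket's `∃ P Es, (A1) ∧ (A2) ∧ (A3) ∧ (A4) ∧ (A5)` BYTES VERBATIM.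
Sources: [Tan1999, §1 Main Theorem; §4 Props. 4.1, 4.4, 4.8]; [MoeglinWaldspurger1995, II.1.7, IV.1.8–IV.1.11]; [Langlands1976, §7]; [Liu2021, Lem. B.10 (2), B.12]; [KudlaRallis1994, §1].
HONEST LABEL.  Count-neutral helper until tied; `HC_CM` is proved only modulo the 7 printed citations (2 remaining named inputs: hLiu418 = `stmt-HodgeConjecture-24832`,
h413 = `stmt-HodgeConjecture-24833`) until rung 0 closes.
-/

set_option autoImplicit false
set_option linter.dupNamespace false -- the mandated namespace repeats `HodgeConjecture.HodgeConjecture`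

noncomputable section

open scoped Matrix Topology ENNReal NNReal BigOperators
open NumberField IsDedekindDomain MeasureTheory Filter
open Literature.NumberTheory.Automorphic Literature.NumberTheory.GaloisRepresentations
open Literature.NumberTheory.GelbartRogawski1991 Literature.NumberTheory.GelbartRogawski1991.GRConstruction
open Literature.NumberTheory.K2Lit.SiegelDoubled Literature.MeasureTheory.Group
open Literature.NumberTheory.Automorphic.IdeleClassGroup

namespace Summit.HodgeConjecture.HodgeConjecture.Cruxes.HLiu418.K2LiuSiegelEisensteinContinuationTop

open K2LiuSiegelUnipotentFourierDefs K2LiuSiegelFourierExpansionDelta K2LiuSiegelEisensteinContinuous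
open K2LiuSiegelEisensteinAssembly K2LiuSiegelEisensteinDoubledLeftInvariant
open K2LiuRankOneCentralVanishing (slice_invariant)

/-! ## §1 The expansion letter `heq` of ★ Φ9 from ★ Φ1 at `φ := E^Δ(·; f_s)` -/

section Expansion

variable (L : Type) [Field L] [NumberField L] [IsCMField L] {N M n : ℕ} (e : Fin N × Fin M ≃ Fin n)
  (dV : Fin N → L) (hdV : ∀ i, IsCMField.complexConj L (dV i) = dV i)
  (dW : Fin M → L) (hdW : ∀ i, IsCMField.complexConj L (dW i) = dW i)
variable [MeasurableSpace (unipDelta L e dV hdV dW hdW)] [BorelSpace (unipDelta L e dV hdV dW hdW)]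

/-- **Φ1 AT THE EISENSTEIN SERIES**: on the convergence half-plane `{n∕2 < re s}`, for a unitary `χ` and a continuous Siegel section `f_s`, the Fourier coefficients of `E^Δ(·; f_s)` along
`N_Δ(L⁺)∖N_Δ(𝔸)` SUM to `E^Δ(h; f_s)` as soon as they are absolutely summable at `h` (`hφc` ★ G8, `hφ` ★ #10b + ★ `slice_invariant`). [cite: MoeglinWaldspurger1995, II.1.7, IV.1.8]
[cite: Tan1999, §1] -/
theorem hasSum_fourierCoeffDelta_eisensteinSeries (hdV0 : ∀ i, dV i ≠ 0) (hdW0 : ∀ i, dW i ≠ 0)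
    (νN : Measure (unipDelta L e dV hdV dW hdW)) [νN.IsMulLeftInvariant]
    {β : unipDelta L e dV hdV dW hdW → ℝ≥0∞} (hβ : IsCoveringWeight (unipDeltaRat L e dV hdV dW hdW) β)
    (hβ0 : ∫⁻ u, β u ∂νN ≠ 0) (hβtop : ∫⁻ u, β u ∂νN ≠ ∞)
    {χ : HeckeCharacter L} (hχ : χ.IsUnitary) {s : ℂ} (hs : (n : ℝ) / 2 < s.re)
    {φ : HA L e dV hdV dW hdW → ℂ} (hφ : IsSiegelDeltaSection L e dV hdV dW hdW χ s φ) (hφc : Continuous φ) (h : HA L e dV hdV dW hdW)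
    (hsum : Summable fun S : skewMatrices ((IsCMField.complexConj L : L ≃ₐ[Fp L] L) : L →+* L) ((gramR L e dV hdV dW hdW).map (algebraMap (Fp L) L)) =>
      ‖fourierCoeffDelta L e dV hdV dW hdW νN β (S : Matrix (Fin n) (Fin n) L) (eisensteinSeriesDelta L e dV hdV dW hdW φ) h‖) :
    HasSum (fun S : skewMatrices ((IsCMField.complexConj L : L ≃ₐ[Fp L] L) : L →+* L) ((gramR L e dV hdV dW hdW).map (algebraMap (Fp L) L)) =>
        fourierCoeffDelta L e dV hdV dW hdW νN β (S : Matrix (Fin n) (Fin n) L) (eisensteinSeriesDelta L e dV hdV dW hdW φ) h)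
      (eisensteinSeriesDelta L e dV hdV dW hdW φ h) :=
  hasSum_fourierCoeffDelta L e dV hdV dW hdW hdV0 hdW0 νN hβ hβ0 hβtop
    (continuous_eisensteinSeriesDelta_unipDelta_mul L e dV hdV hdV0 dW hdW hdW0 hχ hs hφ hφc h)
    (slice_invariant L e dV hdV dW hdW (fun γ hγ h' => siegelEisensteinDoubledLeftInvariant L e dV hdV dW hdW χ s φ hφ ⟨γ, hγ⟩ h') h) hsum

/-- **★ Φ9's `heq` FROM THE COEFFICIENT IDENTITY**: if term packages `Ec S` satisfy `Ec S s h = (∏_{p∈P}(s−p))·(E^Δ(·; f_s))_S(h)` on `{n∕2 < re}` and admit at `(s, h)` a summable bound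
(`hbd`; vacuous when `∏(s−p) = 0`), then `Σ_S Ec S s h = (∏_{p∈P}(s−p))·E^Δ(h; f_s)` there. [cite: MoeglinWaldspurger1995, IV.1.8–IV.1.9] [cite: Tan1999, §4 Prop. 4.8] -/
theorem hasSum_termPackages (hdV0 : ∀ i, dV i ≠ 0) (hdW0 : ∀ i, dW i ≠ 0)
    (νN : Measure (unipDelta L e dV hdV dW hdW)) [νN.IsMulLeftInvariant]
    {β : unipDelta L e dV hdV dW hdW → ℝ≥0∞} (hβ : IsCoveringWeight (unipDeltaRat L e dV hdV dW hdW) β)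
    (hβ0 : ∫⁻ u, β u ∂νN ≠ 0) (hβtop : ∫⁻ u, β u ∂νN ≠ ∞)
    {χ : HeckeCharacter L} (hχ : χ.IsUnitary) {f : ℂ → HA L e dV hdV dW hdW → ℂ}
    (hf : ∀ s, IsSiegelDeltaSection L e dV hdV dW hdW χ s (f s)) (hfc : ∀ s, Continuous (f s)) (P : Finset ℂ)
    (Ec : skewMatrices ((IsCMField.complexConj L : L ≃ₐ[Fp L] L) : L →+* L) ((gramR L e dV hdV dW hdW).map (algebraMap (Fp L) L)) → ℂ → HA L e dV hdV dW hdW → ℂ)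
    (hcoef : ∀ (S : skewMatrices ((IsCMField.complexConj L : L ≃ₐ[Fp L] L) : L →+* L) ((gramR L e dV hdV dW hdW).map (algebraMap (Fp L) L)))
      (s : ℂ) (h : HA L e dV hdV dW hdW), (n : ℝ) / 2 < s.re →
        Ec S s h = (∏ p ∈ P, (s - p)) * fourierCoeffDelta L e dV hdV dW hdW νN β (S : Matrix (Fin n) (Fin n) L) (eisensteinFamilyDelta L e dV hdV dW hdW f s) h)
    {s : ℂ} (hs : (n : ℝ) / 2 < s.re) (h : HA L e dV hdV dW hdW)
    (hbd : (∏ p ∈ P, (s - p)) ≠ 0 → ∃ m : skewMatrices ((IsCMField.complexConj L : L ≃ₐ[Fp L] L) : L →+* L) ((gramR L e dV hdV dW hdW).map (algebraMap (Fp L) L)) → ℝ,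
      Summable m ∧ ∀ S, ‖Ec S s h‖ ≤ m S) :
    HasSum (fun S : skewMatrices ((IsCMField.complexConj L : L ≃ₐ[Fp L] L) : L →+* L) ((gramR L e dV hdV dW hdW).map (algebraMap (Fp L) L)) => Ec S s h)
      ((∏ p ∈ P, (s - p)) * eisensteinFamilyDelta L e dV hdV dW hdW f s h) := by
  by_cases hc : (∏ p ∈ P, (s - p)) = 0
  · -- the prefix vanishes: every term and the target are `0`
    have h0 : ∀ S : skewMatrices ((IsCMField.complexConj L : L ≃ₐ[Fp L] L) : L →+* L) ((gramR L e dV hdV dW hdW).map (algebraMap (Fp L) L)),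
        Ec S s h = 0 := fun S => by rw [hcoef S s h hs, hc, zero_mul]
    rw [hc, zero_mul]
    simpa only [h0] using (hasSum_zero :
      HasSum (fun _ : skewMatrices ((IsCMField.complexConj L : L ≃ₐ[Fp L] L) : L →+* L) ((gramR L e dV hdV dW hdW).map (algebraMap (Fp L) L)) => (0 : ℂ)) 0)
  · -- summability of the coefficients from the bound on the packages
    obtain ⟨m, hm, hle⟩ := hbd hc
    have hsum : Summable fun S : skewMatrices ((IsCMField.complexConj L : L ≃ₐ[Fp L] L) : L →+* L) ((gramR L e dV hdV dW hdW).map (algebraMap (Fp L) L)) =>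
        ‖fourierCoeffDelta L e dV hdV dW hdW νN β (S : Matrix (Fin n) (Fin n) L) (eisensteinSeriesDelta L e dV hdV dW hdW (f s)) h‖ := by
      refine Summable.of_nonneg_of_le (fun _ => norm_nonneg _) (fun S => ?_) (hm.div_const ‖∏ p ∈ P, (s - p)‖)
      have h1 := hle S
      rw [hcoef S s h hs, norm_mul] at h1
      rw [le_div_iff₀ (norm_pos_iff.2 hc), mul_comm]
      exact h1
    have hE := hasSum_fourierCoeffDelta_eisensteinSeries L e dV hdV dW hdW hdV0 hdW0 νN hβ hβ0 hβtop hχ hs (hf s) (hfc s) h hsum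
    have hE' := hE.mul_left (∏ p ∈ P, (s - p))
    refine hE'.congr_fun fun S => ?_
    rw [hcoef S s h hs]
    rfl

end Expansion

/-! ## §2 THE TOP — socket #41 from the rows of Road Φ (edition 1) -/

section Top

/-- **SOCKET #41 `sig_K2LiuSiegelEisensteinContinuation` FROM THE ROWS OF ROAD Φ (edition 1).**  After the socket's own binders (curve frame `e : Fin 2 × Fin 1 ≃ Fin n`, `lam`
conjugate-symplectic of weight one, standard `𝒦`, standard continuous `f`), the ORGAN SIDE in ★ Φ1's coefficient currency: a Fourier carrier (`νN` left-invariant, covering weight `β` of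
positive finite mass), a pole set `P`, TERM PACKAGES `Ec S` indexed by the lattice `skewMatrices` — holomorphic in `s` on `{0 < re}` (`hd`), continuous in `h` (`hc`), EQUAL on `{n∕2 < re}`
to `(∏_{p∈P}(s−p))·` the `S`-th Fourier coefficient of `E^Δ(·; f_s)` (`hcoef`: rows G1–G4 for `det S ≠ 0`, the ★ cleared rank-one package for `det S = 0 ≠ S`, ★ rank-zero + Φ8 + identity
for `S = 0`) — and ★ Φ9's majorant `hmaj` and summed growth `hgrowth` (rows G4 × G5 × G7).  THEN the socket's body: `∃ P Es`, (A1) ∧ (A2) ∧ (A3) ∧ (A4) ∧ (A5), BYTES VERBATIM — by ★ Φ1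
(`heq`, §1) and ★ Φ9 (last line of record). [cite: Tan1999, §1 Main Theorem p. 166; §4 Props. 4.1, 4.4, 4.8] [cite: MoeglinWaldspurger1995, II.1.7, IV.1.8–IV.1.11]
[cite: Liu2021, Lem. B.10 (2) p. 102; Lem. B.12 pp. 103–104] [cite: KudlaRallis1994, §1] -/
theorem siegelEisensteinContinuation_of_rows
    (L : Type) [Field L] [NumberField L] [IsCMField L] {n : ℕ} (e : Fin 2 × Fin 1 ≃ Fin n)
    (dV : Fin 2 → L) (hdV : ∀ i, IsCMField.complexConj L (dV i) = dV i) (hdV0 : ∀ i, dV i ≠ 0)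
    (dW : Fin 1 → L) (hdW : ∀ i, IsCMField.complexConj L (dW i) = dW i) (hdW0 : ∀ i, dW i ≠ 0)
    (lam : IdeleClassGroup L →ₜ* Circle) (_hlam : IsConjugateSymplectic L lam) (_hw : HasWeight L lam 1)
    (𝒦 : IwasawaDatum L e dV hdV dW hdW) (_h𝒦 : 𝒦.IsStd) (f : ℂ → HA L e dV hdV dW hdW → ℂ)
    (hstd : IsStandardSectionFamily 𝒦 (toHeckeCharacter L lam⁻¹) f) (hcont : ∀ s, Continuous (f s))
    -- the organ side, edition 1 (★ Φ1's coefficient currency)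
    [MeasurableSpace (unipDelta L e dV hdV dW hdW)] [BorelSpace (unipDelta L e dV hdV dW hdW)]
    (νN : Measure (unipDelta L e dV hdV dW hdW)) [νN.IsMulLeftInvariant]
    (β : unipDelta L e dV hdV dW hdW → ℝ≥0∞) (hβ : IsCoveringWeight (unipDeltaRat L e dV hdV dW hdW) β)
    (hβ0 : ∫⁻ u, β u ∂νN ≠ 0) (hβtop : ∫⁻ u, β u ∂νN ≠ ∞) (P : Finset ℂ)
    (Ec : skewMatrices ((IsCMField.complexConj L : L ≃ₐ[Fp L] L) : L →+* L) ((gramR L e dV hdV dW hdW).map (algebraMap (Fp L) L)) → ℂ → HA L e dV hdV dW hdW → ℂ)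
    (hd : ∀ S (h : HA L e dV hdV dW hdW), DifferentiableOn ℂ (fun s => Ec S s h) {s : ℂ | 0 < s.re})
    (hc : ∀ S (s : ℂ), 0 < s.re → Continuous (Ec S s))
    (hcoef : ∀ (S : skewMatrices ((IsCMField.complexConj L : L ≃ₐ[Fp L] L) : L →+* L) ((gramR L e dV hdV dW hdW).map (algebraMap (Fp L) L)))
      (s : ℂ) (h : HA L e dV hdV dW hdW), (n : ℝ) / 2 < s.re →
        Ec S s h = (∏ p ∈ P, (s - p)) * fourierCoeffDelta L e dV hdV dW hdW νN β (S : Matrix (Fin n) (Fin n) L) (eisensteinFamilyDelta L e dV hdV dW hdW f s) h)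
    (hmaj : ∀ z : ℂ, 0 < z.re → ∀ h₀ : HA L e dV hdV dW hdW, ∃ r > (0 : ℝ), ∃ V ∈ 𝓝 h₀,
      ∃ m : skewMatrices ((IsCMField.complexConj L : L ≃ₐ[Fp L] L) : L →+* L) ((gramR L e dV hdV dW hdW).map (algebraMap (Fp L) L)) → ℝ, Summable m ∧
        ∀ s : ℂ, dist s z < r → ∀ h ∈ V, ∀ S, ‖Ec S s h‖ ≤ m S)
    (hgrowth : ∀ z : ℂ, 0 < z.re → ∃ C A r : ℝ, 0 < r ∧ ∀ s : ℂ, dist s z < r → ∀ h : HA L e dV hdV dW hdW,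
      ∑' S, ‖Ec S s h‖ ≤ C * adelicHeightGL (n + n) L (h : GL (Fin (n + n)) (AdeleRing (𝓞 L) L)) ^ A) :
    ∃ (P : Finset ℂ) (Es : ℂ → HA L e dV hdV dW hdW → ℂ),
      (∀ h : HA L e dV hdV dW hdW, DifferentiableOn ℂ (fun s => Es s h) {s : ℂ | 0 < s.re}) ∧
      (∀ s : ℂ, 0 < s.re → Continuous (Es s)) ∧
      (∀ s : ℂ, 0 < s.re → ∀ (γ : ratH L e dV hdV dW hdW) (h : HA L e dV hdV dW hdW),
        Es s ((γ : HA L e dV hdV dW hdW) * h) = Es s h) ∧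
      (∀ (s : ℂ) (h : HA L e dV hdV dW hdW), (n : ℝ) / 2 < s.re →
        Es s h = (∏ p ∈ P, (s - p)) * eisensteinFamilyDelta L e dV hdV dW hdW f s h) ∧
      (∀ z : ℂ, 0 < z.re → ∃ C A r : ℝ, 0 < r ∧ ∀ s : ℂ, dist s z < r → ∀ h : HA L e dV hdV dW hdW,
        ‖Es s h‖ ≤ C * adelicHeightGL (n + n) L (h : GL (Fin (n + n)) (AdeleRing (𝓞 L) L)) ^ A) := by
  have hχ : (toHeckeCharacter L lam⁻¹).IsUnitary := isUnitary_toHeckeCharacter L lam⁻¹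
  -- ★ Φ9's `heq` from ★ Φ1, with the pointwise summable bound read off the majorant at `(s, h)`
  have heq : ∀ (s : ℂ) (h : HA L e dV hdV dW hdW), (n : ℝ) / 2 < s.re →
      HasSum (fun S => Ec S s h) ((∏ p ∈ P, (s - p)) * eisensteinFamilyDelta L e dV hdV dW hdW f s h) := by
    intro s h hs
    have hs0 : 0 < s.re := lt_of_le_of_lt (by positivity) hs
    refine hasSum_termPackages L e dV hdV dW hdW hdV0 hdW0 νN hβ hβ0 hβtop hχ hstd.1.1 hcont P Ec hcoef hs h fun _ => ?_
    obtain ⟨r, hr, V, hV, m, hm, hle⟩ := hmaj s hs0 h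
    exact ⟨m, hm, fun S => hle s (by rw [dist_self]; exact hr) h (mem_of_mem_nhds hV) S⟩
  exact exists_continuation_package_of_term_packages L e dV hdV dW hdW (toHeckeCharacter L lam⁻¹) f hstd.1.1 P Ec hd hc heq hmaj hgrowth

end Top

/-! ## §3 Edition 2 — the Fourier carrier constructed INSIDE (★ Φ3b Haar on `N_Δ(𝔸)`, ★ (C0) cocompact cover, ★ covering weight of finite positive mass);
the coefficient identity carrier-generic -/

section Top2

open K2LiuSiegelUnipotentHaarPinned (locallyCompactSpace_unipDelta)
open K2LiuUnipotentCocompact (exists_isCompact_cover_unipDelta)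
open K2LiuUnipotentCoveringWeight (exists_isCoveringWeight_unipDeltaRat_lintegral_ne_top countable_unipDeltaRat)
open K2LiuUnipDeltaConjMeasurePreserving (lintegral_ne_zero_of_isCoveringWeight)

/-- **SOCKET #41 FROM THE ROWS OF ROAD Φ, edition 2 — NO CARRIER BINDERS.**  As `siegelEisensteinContinuation_of_rows`, but the Fourier carrier is BUILT in the proof: `νN :=` the Haar
measure of `N_Δ(𝔸)` (★ `locallyCompactSpace_unipDelta`), `β :=` an `N_Δ(L⁺)`-covering weight of finite mass on ★ (C0)'s cocompact cover (★ `exists_isCoveringWeight_unipDeltaRat_lintegral_ne_top`),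
of non-zero mass (★ `lintegral_ne_zero_of_isCoveringWeight`, ★ `countable_unipDeltaRat`); the coefficient identity `hcoef` is taken CARRIER-GENERIC (every payer is: the coefficient is
weight-independent, ★ `fourierCoeffDelta_eq_of_isCoveringWeight`).  Remaining by value: `P`, the lattice-indexed packages `Ec` with (i)(ii)(iv), Φ9's `hmaj`∕`hgrowth`; the Borel
structure on `N_Δ(𝔸)` stays an instance binder (the tie `borelize`s).  Conclusion = socket #41 BYTES VERBATIM. [cite: Tan1999, §1 Main Theorem; §4 Props. 4.1, 4.4, 4.8]
[cite: MoeglinWaldspurger1995, II.1.7, IV.1.8–IV.1.11] [cite: Liu2021, Lem. B.10 (2), B.12] -/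
theorem siegelEisensteinContinuation_of_rows₂
    (L : Type) [Field L] [NumberField L] [IsCMField L] {n : ℕ} (e : Fin 2 × Fin 1 ≃ Fin n)
    (dV : Fin 2 → L) (hdV : ∀ i, IsCMField.complexConj L (dV i) = dV i) (hdV0 : ∀ i, dV i ≠ 0)
    (dW : Fin 1 → L) (hdW : ∀ i, IsCMField.complexConj L (dW i) = dW i) (hdW0 : ∀ i, dW i ≠ 0)
    (lam : IdeleClassGroup L →ₜ* Circle) (hlam : IsConjugateSymplectic L lam) (hw : HasWeight L lam 1)
    (𝒦 : IwasawaDatum L e dV hdV dW hdW) (h𝒦 : 𝒦.IsStd) (f : ℂ → HA L e dV hdV dW hdW → ℂ)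
    (hstd : IsStandardSectionFamily 𝒦 (toHeckeCharacter L lam⁻¹) f) (hcont : ∀ s, Continuous (f s))
    -- the organ side, edition 2
    [MeasurableSpace (unipDelta L e dV hdV dW hdW)] [BorelSpace (unipDelta L e dV hdV dW hdW)] (P : Finset ℂ)
    (Ec : skewMatrices ((IsCMField.complexConj L : L ≃ₐ[Fp L] L) : L →+* L) ((gramR L e dV hdV dW hdW).map (algebraMap (Fp L) L)) → ℂ → HA L e dV hdV dW hdW → ℂ)
    (hd : ∀ S (h : HA L e dV hdV dW hdW), DifferentiableOn ℂ (fun s => Ec S s h) {s : ℂ | 0 < s.re})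
    (hc : ∀ S (s : ℂ), 0 < s.re → Continuous (Ec S s))
    (hcoef : ∀ (νN : Measure (unipDelta L e dV hdV dW hdW)) [νN.IsHaarMeasure] (β : unipDelta L e dV hdV dW hdW → ℝ≥0∞),
      IsCoveringWeight (unipDeltaRat L e dV hdV dW hdW) β → ∫⁻ u, β u ∂νN ≠ 0 → ∫⁻ u, β u ∂νN ≠ ∞ →
      ∀ (S : skewMatrices ((IsCMField.complexConj L : L ≃ₐ[Fp L] L) : L →+* L) ((gramR L e dV hdV dW hdW).map (algebraMap (Fp L) L)))
        (s : ℂ) (h : HA L e dV hdV dW hdW), (n : ℝ) / 2 < s.re →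
        Ec S s h = (∏ p ∈ P, (s - p)) * fourierCoeffDelta L e dV hdV dW hdW νN β (S : Matrix (Fin n) (Fin n) L) (eisensteinFamilyDelta L e dV hdV dW hdW f s) h)
    (hmaj : ∀ z : ℂ, 0 < z.re → ∀ h₀ : HA L e dV hdV dW hdW, ∃ r > (0 : ℝ), ∃ V ∈ 𝓝 h₀,
      ∃ m : skewMatrices ((IsCMField.complexConj L : L ≃ₐ[Fp L] L) : L →+* L) ((gramR L e dV hdV dW hdW).map (algebraMap (Fp L) L)) → ℝ, Summable m ∧
        ∀ s : ℂ, dist s z < r → ∀ h ∈ V, ∀ S, ‖Ec S s h‖ ≤ m S)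
    (hgrowth : ∀ z : ℂ, 0 < z.re → ∃ C A r : ℝ, 0 < r ∧ ∀ s : ℂ, dist s z < r → ∀ h : HA L e dV hdV dW hdW,
      ∑' S, ‖Ec S s h‖ ≤ C * adelicHeightGL (n + n) L (h : GL (Fin (n + n)) (AdeleRing (𝓞 L) L)) ^ A) :
    ∃ (P : Finset ℂ) (Es : ℂ → HA L e dV hdV dW hdW → ℂ),
      (∀ h : HA L e dV hdV dW hdW, DifferentiableOn ℂ (fun s => Es s h) {s : ℂ | 0 < s.re}) ∧
      (∀ s : ℂ, 0 < s.re → Continuous (Es s)) ∧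
      (∀ s : ℂ, 0 < s.re → ∀ (γ : ratH L e dV hdV dW hdW) (h : HA L e dV hdV dW hdW),
        Es s ((γ : HA L e dV hdV dW hdW) * h) = Es s h) ∧
      (∀ (s : ℂ) (h : HA L e dV hdV dW hdW), (n : ℝ) / 2 < s.re →
        Es s h = (∏ p ∈ P, (s - p)) * eisensteinFamilyDelta L e dV hdV dW hdW f s h) ∧
      (∀ z : ℂ, 0 < z.re → ∃ C A r : ℝ, 0 < r ∧ ∀ s : ℂ, dist s z < r → ∀ h : HA L e dV hdV dW hdW,
        ‖Es s h‖ ≤ C * adelicHeightGL (n + n) L (h : GL (Fin (n + n)) (AdeleRing (𝓞 L) L)) ^ A) := by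
  haveI : LocallyCompactSpace (unipDelta L e dV hdV dW hdW) := locallyCompactSpace_unipDelta L e dV hdV dW hdW
  haveI : Countable (unipDeltaRat L e dV hdV dW hdW) := countable_unipDeltaRat L e dV hdV dW hdW
  -- the carrier: Haar measure + a covering weight of finite positive mass on the cocompact cover
  obtain ⟨K, hK, hcover⟩ := exists_isCompact_cover_unipDelta L e dV hdV dW hdW hdV0 hdW0
  obtain ⟨β, hβ, -, -, hβtop⟩ :=
    exists_isCoveringWeight_unipDeltaRat_lintegral_ne_top L e dV hdV dW hdW (Measure.haar : Measure (unipDelta L e dV hdV dW hdW)) hK hcover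
  have hν : (Measure.haar : Measure (unipDelta L e dV hdV dW hdW)) ≠ 0 := by
    intro h0
    have h1 := isOpen_univ.measure_ne_zero (Measure.haar : Measure (unipDelta L e dV hdV dW hdW)) Set.univ_nonempty
    rw [h0] at h1
    exact h1 rfl
  have hβ0 : ∫⁻ u, β u ∂(Measure.haar : Measure (unipDelta L e dV hdV dW hdW)) ≠ 0 :=
    lintegral_ne_zero_of_isCoveringWeight _ hν (unipDeltaRat L e dV hdV dW hdW) hβ
  exact siegelEisensteinContinuation_of_rows L e dV hdV hdV0 dW hdW hdW0 lam hlam hw 𝒦 h𝒦 f hstd hcont Measure.haar β hβ hβ0 hβtop P Ec hd hc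
    (hcoef Measure.haar β hβ hβ0 hβtop) hmaj hgrowth

end Top2

end Summit.HodgeConjecture.HodgeConjecture.Cruxes.HLiu418.K2LiuSiegelEisensteinContinuationTop

end
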